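import Summits.BirchSwinnertonDyer.Rank1Residual.Supersingular.SignedRankOneCorA5
import Literature.NumberTheory.EllipticCurves.HeegnerPointsImaginaryQuadraticProofs
import Literature.NumberTheory.QuadraticFields.KroneckerSplitting
import Literature.NumberTheory.QuadraticFields.FundamentalDiscriminant
import Literature.NumberTheory.QuadraticFields.DedekindZetaReducedForms
import HarnessLib

/-!
# The CELL-VERIFIED SCOPE of Burungale–Skinner–Tian–Wan Thm. 1.3 as a typed OPEN binder: semistable
# `E`, supersingular `p ≥ 5`, and an auxiliary (ram) prime / imaginary quadratic field of the printed
# proof with `p ∤ h_L` — and its class-X6 consumers (cell `bsd-ssimc`, seat `bsd-ssimc-k3-c2` gen 0,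
# planner fragment D0074-bsd-ssimc-seats.md row k3-c2 (2); route `SignedLowerHalves` item 2 =
# stmt-BirchSwinnertonDyer-19000)

HONEST FRAMING (verbatim spirit of the cell README §4): nothing here is a theorem about any curve; an
ANNOUNCED preprint (BSTW, arXiv:2409.01350v2) enters ONLY as an explicitly labelled OPEN binder
(`…_OPEN : Prop`, `[claim: …, under-review]`, NEVER a theorem); published results are consumed BY NAME;
BSD is not proved by any of this; the crux `KobayashiLowerHalfSemistable` stays OPEN on the ledger.
PARTITION (D-0054): X6 ∧ r = 0 (A6) × 13 (+10~) cells × p ∈ {3,5} — here the `p ≥ 5` ones — + X6 r1 +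
literal rows D1/D2 — types-the-object-of; closes none.

## Why this file

The tree's binder `BurungaleSkinnerTianWan2024_thm13_OPEN` (`KobayashiMainConjecture.lean`) is Thm. 1.3
AS PRINTED: every semistable `E`, every supersingular `p > 2` (`a_3 = 0` if `p = 3`), both signs. The
cell's independent line-by-line verification of BSTW's proof (HOME/bstw-MEMO-1…7, referee
REPORT-bstw-1…7) PASSED WITH CELL REPAIRS **at `p ≥ 5`** (REPORT-bstw-6, sha16 7a95ba616d84dc36: G-ledger
EMPTY) with ONE scope rider (referee NOTE-W-ref-2 (α)): the argument is complete for a pair `(E, p)`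
**iff the auxiliary imaginary quadratic field `L` of Part II §2.3 can be chosen with `p ∤ h_L`** (the
`p ∣ h_L` corner rests on the cite-only input C.2(ii) = Rohrlich, Invent. Math. 97 (1989), acq-00283);
at `p = 3` BSTW's own clause cites the preprint [SV-S-Ohta] (REPORT-bstw-7, residual (3-ii)♭). This file
TYPES that verified reading, so that «PRE verified by cell + referee» (a tier question open before
director-bsd / 21-frontier, 2026-08-25T22:14:36Z (3)) is ONE NAMED `Prop`, strictly weaker than the
printed claim (`thm13_scoped_OPEN_of_thm13_OPEN`), and so that a per-class L-WITNESS (the cell's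
W-bstw-10 table) becomes a kernel-checkable hypothesis (`BSTWScope.hasWitness_of_kronecker`: Kronecker
symbols + the form class number `h(−D)`, both `decide`/`norm_num`-evaluable).

## The printed choice being typed (BSTW Part II §2.3, proof of Thm. 2.1 = (KoMC_r); p0076 of the held
text `paper:arxiv-2409.01350`), verbatim

"Since `g` is semistable, there exists a prime `q | N` satisfying the condition (ram) by Ribet's level
raising. Pick an imaginary quadratic field `L` such that (ord) holds and `(D_L, 2N) = 1`. Suppose also
that either `q` is inert in `L` and the primes dividing `N/q` split, or that (def) holds." — with
(ram) = "There exists a prime `ℓ ∥ N` with `ρ̄` ramified at `ℓ`" (p0073), (ord) = "`p` splits in `L`"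
(§1.5.1, p0018). The cell's proof map (HOME/bstw/BSTW-verification-v2.md §2) records this as steps
S1 (the (ram) prime `q₀`) and S2 (choice of `L`: `p` split, `q₀` inert, primes of `N/q₀` split,
`(D_L, 2N) = 1`, **and `2` split in `L` if `2 ∤ N`** — the cell's costless repair G3 of the omitted
hypothesis (spl) of II Thm. 1.24 = [CLW22] §5.2), and the rider (α) as `p ∤ h_L`.

## Contents

* `BSTWScope.IsAuxiliaryPrime W p q` — S1 at a NAMED prime `q`: `q ≠ p`, multiplicative reduction at
  `q`, `p ∤ ord_q(Δ_min)` (⟺ `ρ̄_{E,p}` ramified at `q` by Tate's parametrisation; the body of the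
  tree's `Rank1Residual.Ram W p` at `ℓ = q`).
* `BSTWScope.IsAuxiliaryField W p q L` — S2 + G3 for a number field `L`: imaginary quadratic, `p`
  split, `q` inert, every other bad prime split, `d_L` odd and prime to every bad prime, `2` split if
  `2` is good. "Split"/"inert" in the currency of the tree's Heegner hypothesis
  (`((Ideal.span {ℓ}).primesOver (𝓞 L)).ncard = 2`, resp. `= 1` with `ℓ ∤ d_L`); "`ℓ ∣ N`" as
  "`ℓ` is a prime of bad reduction" (for semistable `E`, `N = ∏_{bad ℓ} ℓ`).
* `BSTWScope.HasWitness W p` — ∃ such `q`, `L` with `p ∤ h_L` (`NumberField.classNumber L`).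
* `BurungaleSkinnerTianWan2024_thm13_scoped_OPEN` — the OPEN binder: `5 ≤ p`, `Semistable W`,
  `GoodSS W p`, `HasWitness W p` ⟹ `KobayashiMainConjecture W p ε` for every sign. NEVER a theorem.
* `thm13_scoped_OPEN_of_thm13_OPEN` — it is implied by the printed binder (sanity: weaker claim).
* Consumers on class X6 at `p ≥ 5` with a witness: the main conjecture, its Eisenstein half
  (`KobayashiLowerDivisibility`, the crux's predicate), `BSD(E,p)` in analytic rank 0 (± road, PUB inputs
  by name) and rank 1 (BKO Cor. A.5 road).
* `BSTWScope.ncard_primesOver_eq_one_of_jacobiSym_eq_neg_one` — the decomposition law's inert case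
  (`(d_L/q) = −1` ⟹ one prime above `q`), companion of the tree's
  `Quadratic.ncard_primesOver_eq_two_iff_jacobiSym`.
* `BSTWScope.hasWitness_of_kronecker` — the witness from DECIDABLE data: a (ram) prime `q` read off the
  model and an odd negative fundamental discriminant `−D` with the right Kronecker symbols and
  `p ∤ h(−D)` (tree: `Quadratic.exists_numberField_discr_eq`, `…_iff_jacobiSym`,
  `ncard_primesOver_two_eq_two_iff`, `card_reducedForms_eq_classNumber`).

## Litref D-audit of record (cell `pub/bsd-litref`, tranche T2b, 2026-08-26) — the p ≥ 5 tier

Reading of record `pub/bsd-litref/bstw24/sheets/D-AUDIT-bstw24-r1.md` 2ab68891cb7b08bc + ADDENDUM-1 dd57a5d99fb5bd7f +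
ADDENDUM-2 5fc2aa1cce88a1ac + ADDENDUM-3 f18da4daf35aa2e0 + ADDENDUM-4 14b633e2f406b0ef + ADDENDUM-5 73386cd869069474
(independent of the cell's memos; the sealed sheet REPORTED the cell's repairs without re-verifying them, ADDENDA 2–3
RE-VERIFIED them first-hand — see VERDICT O6 below). PRINTED NUMBERING (arXiv v2; TeX source sha16 5926f035551c636d; the
cell memos quoted here use the held extraction's numbering, one section low in Part I and restarted in Part II — full
map in `KobayashiMainConjectureX6BSTWScopeThree.lean` § «Litref D-audit»): «Rem. 5.1» = printed Rem. 6.1 (p. 58); «Part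
II §2.3 / Thm. 2.1 / Thm. 2.5 / Thm. 1.24 / Prop. 1.18» = printed §10.3 (p. 88) / Thm. 10.1 (p. 86) / Thm. 10.5 (p. 87)
/ Thm. 9.24 (p. 85) / Prop. 9.18 (p. 83). VERDICT O6 (Thm. 1.3 / 1.5 proof chain at p ≥ 5, this binder's tier):
ARCHITECTURE PASS (steps S1–S8 of §10.3 tabled and the BSTW-internal arguments of §4.1–4.3 / Thm. 10.5's coprimality
step / the §10.3 squeeze re-derived); PRINT GAPPED-in-print at two located places — (G-ii) the §6 normalisation: `J_g =
(λ_N(g)c_g)⁻¹𝒪` (l.5040–5043, p. 59) and `𝒞^int_∘ := c_g·𝒞_∘` (l.5507–5511) versus the factor ((1−pγ⁻²)(1−γ⁻²)λ_N(g))⁻¹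
carried by Thm. 6.8 (ii) (l.5210–5222, p. 61) and not cancelled in Thm. 6.4's printed proof (l.5241–5247) — at γ² = −p
the factor is p/(2(p+1)λ_N(g)), p-adic valuation +1 at every odd p (re-derived r1 §10; Thm. 6.4's ζ = 1 case is moreover
not determined by the cited inputs); inherited by Lem. 6.6, Thm. 6.16, Prop. 6.19 (ii), Prop. 6.25 and the identity of
l.7428 used for μ = 0 in Thm. 10.5 — = the cell's CB10, repaired of record by its normalisation (R1) (bstw-MEMO-3);
(G-i) Thm. 9.24's proof l.7275–7286 (p. 85) «In view of Theorem 4.20 the proof of [CLW, Prop. 8.2.2] applies for the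
case ξ = 𝟙_L»: ADDENDUM-1 (after reading [CLW22]'s conventions first-hand) WITHDRAWS component (i) at p ≥ 5 (on E's
branch the residual-distinctness line reads ω ≢ ω⁻¹, true for p ≥ 5) as a label erratum, keeps (ii) the integrality
sentence outside [CLW22] Thm. 8.2.1 (2) (not load-bearing for Thm. 9.24 / 10.5) and (iii) the unprinted interpolation
identification (bookkeeping) — = the cell's G2, closed/repaired by cell (Lemma T′). ADDENDUM-2 (5fc2aa1cce88a1ac)
RE-VERIFIES the cell repairs first-hand — (G-ii): canonical (Wach–Yager) signed Coleman maps surjective onto 𝓡 (cell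
Theorem A), BSTW's 𝒞_± constant multiples of them (Cor B), the canonical signed L-function integral, satisfying Thm.
6.16 AS PRINTED up to 𝒪_λ^× (Lemma N) and with μ_ac = 0 under (ram) (Theorem G1♮; ADDENDUM-3 f18da4daf35aa2e0 re-derives
G1♮′ for EVERY auxiliary L, a″ ≥ 0 — class-number-free on L — DISPUTED across desks at h_p(L) ≥ 1: cgs25-r2 Q1 on Prop.
4.12's proof l.3385–3386, referee C R381 «counterexample VALID … INCOMPLETE as worded …, VACUOUS at h_p(L) = 0», final
word C4's; r1 ADD-5 73386cd8 concedes the wording and repairs the inference (Lemma S + Lemma T), admission C4's; the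
dispute touches the S-tiers, NOT this (α)-tier (p ∤ h_L ⇒ h_p = 0, l.2711–2713)), the PUB inputs ([Ko03], [LLZ10],
[LZ14], [LZ16], [Ka04], [Lo18], [CH18], [PW11] — items listed in ADD-2 §A) opened at the page and the load-bearing
valuations redone: CONCUR; (G-i)(iii): (eq:intp) of [CLW22] re-read at the page, CONCUR — so O6 @ p ≥ 5 now reads
**PASS-in-cell WITH THE bsd-ssimc CELL REPAIRS (second, independent reader), print gapped-as-printed at the two located
lines (errata, harmless for the theorem)**; residuals = statement-level acceptance of the PUB inputs of ADD-2 §A.6 (+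
the named [CLW22] sub-node `Hid04-density@Ohta26`, referee C R339 / R353) and the cell's own flagged identifications
(★)/(Int)/(A-γ). Not-written steps (l.7069, l.7450–7452, l.7282–7285) and query Q-4.20 (l.3636–3648; integral
normalisations only) as located in the sheet §3. §5 package at p ≥ 5 (r1 O4; SHARPENED by ADDENDUM-4 §B.3 — OFF the
(anom) branch as before, ON it (α² ≡ 1 ∧ ¬(irr_ℚ), l.3760–3763) also modulo the printed-unproved Gr-side sentence
l.4175–4176, RETURN(line)-grade, = referee C R381 (ε)'s line for the 200 (anom) D4 classes with cgs25's «Lemma W» as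
repair candidate, admission C4's; the §5 → Prop. 9.18 path is general in h_p, ADD-4 §C / Q-r08-1): PASS-in-cell MODULO
(a) refereed inputs inside their printed hypotheses and (c) the c̃_g-vs-c_f unit bookkeeping on the CGS side — the two
«readily adapted / case-by-case» steps (l.3301, l.3306–3311) and Q-4.10 are DISCHARGED first-hand by ADD-2 §B ([BD]
§3.2's own sentence; type(𝒯) = 3 in every case of [BD] Thm. 4.8; θ_{ψ_r} automatically p-irregular for r ≤ h_p); r2 N1′
(independent): PASS-in-cell at p ≥ 5 modulo PUBLISHED inputs with two documentary riders — (R-a) «pseudo-null cokernel»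
= printed injectivity + [KLZ17] Thm. 8.2.3 (r2 ADD-1, arXiv:1503.02888 p0071:L19–p0072:L14) + a height-2 annihilator
argument; (R-b) «𝒞^int = c̃_g·𝒞» (l.4221) read with the factor e⋆ = α(1−pα⁻²)(1−α⁻²)λ_N(g) (= CB6 / (R1)); r2 ADDENDUM-6
adds (R-c) l.4175–4177 for Eisenstein / anomalous g (its derivation «D-ω» offered as repair) and (R-d) Q1 at h_p(L) ≥ 1.
Reader 2 (INDEPENDENT; `D-AUDIT-bstw24-r2.md` sha16 69e4de3690fd21dc FROZEN + ADDENDUM-1 850c38dd32e26b8a + ADDENDUM-2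
429d6b8a4b7ba185 + ADDENDUM-3 4e4fd1ddbfa9f33b — the last covering the §4.4.2 loci l.3301 / l.3306–3311 / Prop. 4.9
(iii) first-hand from [BD] / [BDP′]: hypothesis met by construction, printed in [BD] §3.2, type(𝒯) = 3, the 𝟙 ↔ χ_L
swap; «N1′ … needs NO additional rider from §4.4.2») + ADDENDUM-4 f739c7b8993da616 + ADDENDUM-5 e7ed9540d359d276 +
ADDENDUM-6 eaa05811605d1147, verdict N2 on the K3 binders T1–T4 and these tiers: statements VERBATIM / weaker-than-print
twist clause; proof side NOT re-audited by r2 (of record = bsd-ssimc BSTW-verification-v3 2c152cd7c8940032) EXCEPT the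
supersingular §6.2 normalisation — ADDENDUM-4 f739c7b8993da616 re-derives, from the TeX alone (reader 1's record
unopened), Thm. 6.4's constant p/(2(p+1)λ_N(g)) off Thm. 6.8 (ii) ∧ Prop. 6.7 ∧ Thm. 6.2 at every t > 0 (both parities;
γ drops out), the t = 0 indeterminacy (cross term) and its source, the two «J_g» (l.5037–5043 vs l.5141–5150; Lemma
6.6's proof l.5251–5267): CONCUR with r1 (G-ii) / the cell's CB10, downstream propagation left to r1 / bsd-ssimc —; r2's
new g-side component G3g (KLZ17 7.2.3 / 9.5.1–2 / 10.1.1 / 10.2.2 at 3 on the trivial tame eigenspace, tame level N)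
concerns the ORDINARY §5 package behind CGS25 Thm. 4.1.1 and does NOT touch Thm. 1.3's supersingular §6 (no g-side Hida
family); r2 ADD-2 / ADD-5 confirm first-hand the p ≥ 5 legs ([FK]; [Oht00] via [KLZ17]) for THIS tier. Statement side
(r1 O1): VERBATIM / weaker than print — no binder fix. Referee desks on this reading (D-audit desk = referee C4
`pub-bsdpct-r7` since 2026-08-26T22:54Z (litref wakes MOVED r3 → r7, one family per round; director-bsd 22:55:33Z),
before that referee C `pub-bsdpct-r3` (from 19:21Z) and C2 `pub-bsdpct-r4`; wakes
WAKE-AUDIT-LITREF-bstw24-r1-2ab68891cb7b08bc + -add1, -add2, -add3, -add4, -add5, -r2-69e4de3690fd21dc + -add1, -add2,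
-add3, -add4, -add5, -add6): referee C ROUND 353 (ε) (2026-08-26T20:27:48Z, jsw17 group) — «Road K @ p ≥ 5 PASS-in-cell
at the tier of record (… cell-verified regime, REPORT-bstw-6∕-9)»; referee C4's bstw24 family round: ROUND C4-R3
(2026-08-27T00:54:31Z, referee C4 pub-bsdpct-r7, 12 wakes r1 + ADD-1…5, r2 + ADD-1…5): (α) statements «PASS ×2 CONCUR»,
0 fixes; (β) @ 3 «GAP(line), VERDICT OF RECORD»; (γ) @ p ≥ 5 «PASS-in-cell MODULO PUB inputs, VERDICT OF RECORD» (riders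
(R-a), (R-b), l.4175–4176 on (anom)); (ε) «Prop 4.12 = PASS-in-cell WITH READER REPAIR» (r1 ADD-5 Lemma S + T «VERIFIED
AT THIS DESK»; vacuous for this (α)-tier anyway); (ζ) O6, O7 «PASS-in-cell WITH CELL REPAIRS, CONCUR ×2»; full quote in
`KobayashiMainConjectureX6BSTWScopeS.lean`; referee A: not seized (GAP(line) @ 3 ⇒ 0 move; C4-R3 (θ) opens
the pricing gate; the PRICING-A10 record goes to A and its word rides the next substantive edit — cell ruling
2026-08-26T21:02:36Z). Statements in this file are UNCHANGED by the litref pass (typer `bsd-litref-bstw24-ty`).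

References: [BurungaleSkinnerTianWan2024] Thm. 1.3, Part II §2.3 / Thm. 2.1 / Thm. 2.5 (PRE; = printed §10.3 /
Thm. 10.1 / Thm. 10.5);
[Kobayashi2003] Conjecture (p. 2); [SkinnerUrban2014] Thm. 2 (ram); [Cox2013] Thm. 2.13, 7.7(ii);
[Marcus2018] Ch. 3 Thm. 25; cell records REPORT-bstw-6 (7a95ba616d84dc36), NOTE-W-ref-2, REPORT-bstw-7
(40fdbe7e627732c4), bstw-MEMO-1 S1/S2/G3, bstw-MEMO-4 Part A, bstw-MEMO-6 B.1/C.2(ii).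
-/

set_option autoImplicit false

noncomputable section

open scoped Classical MatrixGroups ModularForm

open CongruenceSubgroup WeierstrassCurve NumberField Literature.NumberTheory.EllipticCurves
  Literature.NumberTheory.EllipticCurves.ModularForms
  Literature.NumberTheory.EllipticCurves.Rank1Residual
  Literature.NumberTheory.EllipticCurves.Rank1Residual.Typed

namespace Summit.BirchSwinnertonDyer.Rank1Residual.Supersingular

/-! ### S1, S2 (+ G3) and the rider (α), typed -/

section Scope

/-- **S1 at a named prime** — the (ram) prime of BSTW II §2.3 ("there exists a prime `q | N` satisfying
the condition (ram)"; (ram): "a prime `ℓ ∥ N` with `ρ̄` ramified at `ℓ`"): `q ≠ p`, `E` has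
multiplicative reduction at `q`, and `p ∤ ord_q(Δ_min)` (Tate: `ρ̄_{E,p}` is ramified at the
multiplicative prime `q` iff `p ∤ ord_q(Δ_min)`) — verbatim the body of the tree's `Rank1Residual.Ram W p`
(Skinner–Urban's (ram)) at `ℓ = q`. A predicate; nothing asserted.
[cite: SkinnerUrban2014, Thm. 2 (p. 3), second bullet] -/
def BSTWScope.IsAuxiliaryPrime (W : WeierstrassCurve ℚ) [W.IsGloballyMinimal] (p q : ℕ)
    [Fact q.Prime] : Prop :=
  q ≠ p ∧ W.HasMultiplicativeReductionAtPrime q ∧ ¬ p ∣ padicValInt q W.minimalDiscriminantInt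

/-- **S2 (+ the cell's repair G3) for a number field `L`** — the auxiliary field of BSTW II §2.3 relative
to the (ram) prime `q`: `L` is imaginary quadratic; (ord) `p` splits in `L`; `q` is inert in `L` (one
prime of `𝓞 L` above `q`; unramified by the coprimality clause); every prime `ℓ ≠ q` of bad reduction
splits in `L` ("the primes dividing `N/q` split"); `(D_L, 2N) = 1`, i.e. `d_L` is odd and no bad prime
divides `d_L`; and (G3, = hypothesis (spl) of II Thm. 1.24 / [CLW22] §5.2, omitted in II §2.3 and
restored by the cell, bstw-MEMO-1 S2) `2` splits in `L` when `2` is a prime of good reduction. "Split"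
is spelled as in the tree's `SatisfiesHeegnerHypothesis`. A predicate; nothing asserted.
[cite: GrossLMS1991, §1 (p. 235) (shape of "split" only; nothing asserted)] -/
def BSTWScope.IsAuxiliaryField (W : WeierstrassCurve ℚ) (p q : ℕ) (L : Type) [Field L]
    [NumberField L] : Prop :=
  IsImaginaryQuadratic L ∧
    ((Ideal.span {(p : ℤ)}).primesOver (𝓞 L)).ncard = 2 ∧
    ((Ideal.span {(q : ℤ)}).primesOver (𝓞 L)).ncard = 1 ∧
    (∀ ℓ : ℕ, (hℓ : ℓ.Prime) → ℓ ≠ q →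
      (haveI : Fact ℓ.Prime := ⟨hℓ⟩; ¬ W.HasGoodReductionAtPrime ℓ) →
        ((Ideal.span {(ℓ : ℤ)}).primesOver (𝓞 L)).ncard = 2) ∧
    ¬ (2 : ℤ) ∣ NumberField.discr L ∧
    (∀ ℓ : ℕ, (hℓ : ℓ.Prime) →
      (haveI : Fact ℓ.Prime := ⟨hℓ⟩; ¬ W.HasGoodReductionAtPrime ℓ) → ¬ (ℓ : ℤ) ∣ NumberField.discr L) ∧
    (W.HasGoodReductionAtPrime 2 → ((Ideal.span {(2 : ℤ)}).primesOver (𝓞 L)).ncard = 2)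

/-- **The scope witness of the cell's verified reading (S1 ∧ S2 ∧ (α))**: a (ram) prime `q`, an
auxiliary field `L` as in BSTW II §2.3 relative to `q`, and `p ∤ h_L` — the referee's rider (α)
(NOTE-W-ref-2: "a booked class `(g, p)` is covered by the PASS as issued iff S2's auxiliary `L` can be
taken with `p ∤ h_L`"). Per class it is decidable data (`BSTWScope.hasWitness_of_kronecker`); class-wide
its existence is NOT free (bstw-MEMO-4's bracket: Wiles, JLMS 92 (2015) Thm. 0.0.1 does not supply it
when some split `ℓ ∣ N` has `ℓ ≡ −1 (mod p)`). A predicate; nothing asserted.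
[cite: SkinnerUrban2014, Thm. 2 (p. 3), second bullet (shape of (ram) only; nothing asserted)] -/
def BSTWScope.HasWitness (W : WeierstrassCurve ℚ) [W.IsGloballyMinimal] (p : ℕ) : Prop :=
  ∃ (q : ℕ) (_ : Fact q.Prime) (L : Type) (_ : Field L) (_ : NumberField L),
    BSTWScope.IsAuxiliaryPrime W p q ∧ BSTWScope.IsAuxiliaryField W p q L ∧
      ¬ p ∣ NumberField.classNumber L

/-- **OPEN BINDER — the CELL-VERIFIED SCOPE of Burungale–Skinner–Tian–Wan, arXiv:2409.01350v2, Thm. 1.3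
(= Part II Thm. 2.1, (KoMC_r)).** "Let `E/ℚ` be a semistable elliptic curve, and `p > 2` a supersingular
prime. … Then Kobayashi's Conjecture (Kob) is true", RESTRICTED to the regime the cell bsd-ssimc verified
line by line with referee PASS (REPORT-bstw-6 7a95ba616d84dc36, G-ledger EMPTY, residue (A-γ) / c^δ /
q₀ = 2; scope rider (α) of NOTE-W-ref-2; litref D-audit of record D-AUDIT-bstw24-r1 2ab68891cb7b08bc O6 + ADDENDUM-1
dd57a5d99fb5bd7f + ADDENDA 2–3 5fc2aa1cce88a1ac / f18da4daf35aa2e0: PASS-in-cell WITH THE CELL REPAIRS, re-verified by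
the litref reader (the cell's witness here keeps the rider (α) `p ∤ h_L`; the reading itself is class-number-free per r1
ADD-3 — disputed at h_p(L) ≥ 1, referee C R381, vacuous for this tier —, cf. the S-tier `…_scopedS_OPEN`); print
gapped-as-printed at the §6 normalisation (= CB10 / (R1)) and at Thm. 9.24's proof l.7275–7286 (= G2; label erratum +
bookkeeping) — module docstring § «Litref D-audit»): `p ≥ 5`, and the (ram) prime / auxiliary imaginary quadratic
field of the printed proof (II §2.3) can be taken with `p ∤ h_L` (`BSTWScope.HasWitness W p`).
Conclusion: `KobayashiMainConjecture W p ε` for every sign, on the tree's real objects. Strictly weaker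
than the printed binder `BurungaleSkinnerTianWan2024_thm13_OPEN` (`thm13_scoped_OPEN_of_thm13_OPEN`).
The source is an UNREFEREED PREPRINT: NEVER cite this `Prop` as a theorem; take it as an explicit
hypothesis. Nothing asserted. [claim: BurungaleSkinnerTianWan2024, status: under-review]
[cite: Kobayashi2003, Conjecture (Main Conjecture) (p. 2) (shape of the conclusion only; nothing asserted)] -/
def BurungaleSkinnerTianWan2024_thm13_scoped_OPEN : Prop :=
  ∀ (W : WeierstrassCurve ℚ) [W.IsElliptic] [W.IsGloballyMinimal] (p : ℕ) [Fact p.Prime],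
    5 ≤ p → Semistable W → GoodSS W p → BSTWScope.HasWitness W p →
      ∀ ε : ℤˣ, KobayashiMainConjecture W p ε

/-- The scoped binder is IMPLIED by the printed one (it only adds hypotheses: `p ≥ 5` makes the `p = 3`
proviso vacuous and the witness is dropped) — so taking it is never stronger than taking Thm. 1.3.
[claim: BurungaleSkinnerTianWan2024, status: under-review] -/
theorem thm13_scoped_OPEN_of_thm13_OPEN (h : BurungaleSkinnerTianWan2024_thm13_OPEN) :
    BurungaleSkinnerTianWan2024_thm13_scoped_OPEN := by
  intro W _ _ p _ h5 hsst hss _ ε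
  exact h W p (by omega) hsst hss (fun h3 => by omega) ε

end Scope

/-! ### Class-X6 consumers at `p ≥ 5` with a witness -/

section Consumers

variable (W : WeierstrassCurve ℚ) [W.IsElliptic] [W.IsGloballyMinimal] (p : ℕ) [Fact p.Prime]

/-- **Kobayashi's main conjecture for `(E, p, ε)` on X6 at `p ≥ 5`, MODULO the scoped OPEN binder and a
scope witness.** CONDITIONAL; closes nothing. [claim: BurungaleSkinnerTianWan2024, status: under-review]
[cite: Kobayashi2003, Conjecture (Main Conjecture) (p. 2)] -/
theorem X6.kobayashiMainConjecture_of_thm13_scoped_OPEN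
    (h : BurungaleSkinnerTianWan2024_thm13_scoped_OPEN) (h5 : 5 ≤ p) (hX : ClassX6 W p)
    (hw : BSTWScope.HasWitness W p) (ε : ℤˣ) : KobayashiMainConjecture W p ε :=
  h W p h5 hX.2.1 hX.1 hw ε

/-- **The Eisenstein half (the predicate of crux `KobayashiLowerHalfSemistable`) on X6 at `p ≥ 5`,
MODULO the scoped OPEN binder and a scope witness**, for every sign. CONDITIONAL; closes nothing.
[claim: BurungaleSkinnerTianWan2024, status: under-review] [cite: Kobayashi2003, Conjecture (Main Conjecture) (p. 2)] -/
theorem X6.kobayashiLowerDivisibility_of_thm13_scoped_OPEN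
    (h : BurungaleSkinnerTianWan2024_thm13_scoped_OPEN) (h5 : 5 ≤ p) (hX : ClassX6 W p)
    (hw : BSTWScope.HasWitness W p) (ε : ℤˣ) : KobayashiLowerDivisibility W p ε :=
  kobayashiLowerDivisibility_of_mainConjecture
    (X6.kobayashiMainConjecture_of_thm13_scoped_OPEN W p h h5 hX hw ε)

/-- **`BSD(E,p)` on X6 ∧ {r_an = 0} at `p ≥ 5`, MODULO the scoped OPEN binder and a scope witness**, the
rest PUBLISHED and by name (Wuthrich Prop. 21 `hW`, Kobayashi Thm. 1.2 `h12`, B. D. Kim Cor. 3.15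
`hKim`, Pollack `hPollack`, modularity `hmod`/`hmod'`, GZK `hGZK`) through the tree's ± rank-zero road.
This is the typed form of RELAY-4's clause «A6 @ p ≥ 5 bookable with a per-class L-witness».
CONDITIONAL; closes nothing. [claim: BurungaleSkinnerTianWan2024, status: under-review]
[cite: Wuthrich2014, Prop. 21 (p. 400)] [cite: Miller2011LMS, §1 and Def. 1.1] -/
theorem X6.bsdp_of_thm13_scoped_OPEN_of_analyticRank_eq_zero
    (h : BurungaleSkinnerTianWan2024_thm13_scoped_OPEN)
    (hW : Wuthrich2014.sha_dvd_analyticSha)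
    (h12 : Kobayashi2003.thm12_signedSelmerDual_finite_torsion)
    (hKim : BDKim2013.cor315_signedCharValue_rankZero)
    (hPollack : ∀ {N : ℕ} [NeZero N] {f : CuspForm (Gamma0 N) 2},
      pollack_exists_plusMinusPAdicLFunction (W := W) (f := f) (p := p))
    (hmod : nonempty_modularParametrizationData) (hmod' : hasEntireLFunction_rat)
    (hGZK : rank_eq_analyticRank_of_analyticRank_le_one)
    (h5 : 5 ≤ p) (hX : ClassX6 W p) (hw : BSTWScope.HasWitness W p) (h0 : W.analyticRank = 0) :
    BSDp W p :=
  X6.bsdp_of_kobayashiMainConjecture_of_analyticRank_eq_zero W p hW h12 hKim hPollack hmod hmod' hGZK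
    (by omega) hX h0 (X6.kobayashiMainConjecture_of_thm13_scoped_OPEN W p h h5 hX hw 1)

/-- **`BSD(E,p)` on X6 ∧ {r_an = 1} at `p ≥ 5`, MODULO the scoped OPEN binder and a scope witness**, via
Burungale–Kobayashi–Ota 2024 Cor. A.5 (`hA5`, PUB, flags recorded in its docstring), modularity and GZK —
the typed form of RELAY-5's D2 clause with a per-class L-witness. CONDITIONAL; closes nothing.
[claim: BurungaleSkinnerTianWan2024, status: under-review] [cite: BurungaleKobayashiOta2023, App. A Cor. A.5]
[cite: Miller2011LMS, §1 and Def. 1.1] -/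
theorem X6.bsdp_of_thm13_scoped_OPEN_of_corA5_of_analyticRank_eq_one
    (h : BurungaleSkinnerTianWan2024_thm13_scoped_OPEN)
    (hA5 : BurungaleKobayashiOta2024.corA5_pPart_of_signedCharIdeal_eq) (hmod : hasEntireLFunction_rat)
    (hGZK : rank_eq_analyticRank_of_analyticRank_le_one)
    (h5 : 5 ≤ p) (hX : ClassX6 W p) (hw : BSTWScope.HasWitness W p) (h1 : W.analyticRank = 1) :
    BSDp W p :=
  X6.bsdp_of_kobayashiMainConjecture_of_corA5_of_analyticRank_eq_one W p hA5 hmod hGZK (by omega) hX h1 1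
    (X6.kobayashiMainConjecture_of_thm13_scoped_OPEN W p h h5 hX hw 1)

end Consumers

end Summit.BirchSwinnertonDyer.Rank1Residual.Supersingular

/-! ### The decomposition law, inert case (companion of `ncard_primesOver_eq_two_iff_jacobiSym`) -/

namespace Summit.BirchSwinnertonDyer.Rank1Residual.Supersingular.BSTWScope

open Module Polynomial Ideal UniqueFactorizationMonoid Literature.NumberTheory.QuadraticFields.Quadratic

/-- **Inert case of the decomposition law.** For a quadratic field `K` and a prime `p` with Jacobi
symbol `(d_K/p) = −1` (so `p` is odd: at `p = 2` the symbol is never `−1`), there is exactly ONE prime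
of `𝓞 K` above `p` (Marcus, *Number Fields*, Ch. 3, Thm. 25): with an integral basis `(1, ω)`,
`ω² = m + tω`, `minpoly ω = X² − tX − m` has discriminant `d_K = t² + 4m`, a non-square mod `p`, so it
stays irreducible mod `p` (Dedekind–Kummer, `ncard_primesOver_eq_card_toFinset`). [folklore] -/
theorem ncard_primesOver_eq_one_of_jacobiSym_eq_neg_one {K : Type*} [Field K] [NumberField K]
    (h2 : finrank ℚ K = 2) {p : ℕ} (hp : p.Prime)
    (hj : jacobiSym (NumberField.discr K) p = -1) :
    ((span {(p : ℤ)}).primesOver (𝓞 K)).ncard = 1 := by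
  haveI : Fact p.Prime := ⟨hp⟩
  obtain ⟨b, hb⟩ := exists_basis_zero_eq_one h2
  have hl : legendreSym p (NumberField.discr K) = -1 := by
    rw [jacobiSym.legendreSym.to_jacobiSym]; exact hj
  rw [ncard_primesOver_eq_card_toFinset b hb]
  rw [discr_eq_sq_add_four_mul b hb] at hl
  generalize b.repr (b 1 * b 1) 1 = t at hl ⊢
  generalize b.repr (b 1 * b 1) 0 = m at hl ⊢
  have hcast : (((t ^ 2 + 4 * m : ℤ)) : ZMod p) = (t : ZMod p) ^ 2 + 4 * (m : ZMod p) := by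
    push_cast
    ring
  have hns : ¬ IsSquare ((t : ZMod p) ^ 2 + 4 * (m : ZMod p)) :=
    hcast ▸ (legendreSym.eq_neg_one_iff p).mp hl
  exact card_toFinset_normalizedFactors_X_sq_sub_of_not_isSquare hns

end Summit.BirchSwinnertonDyer.Rank1Residual.Supersingular.BSTWScope

/-! ### The witness from decidable data -/

namespace Summit.BirchSwinnertonDyer.Rank1Residual.Supersingular

open Literature.NumberTheory.QuadraticFields

/-- **A scope witness from DECIDABLE data.** For a globally minimal `W`, an odd prime `p`, a (ram)
prime `q` (`BSTWScope.IsAuxiliaryPrime W p q`, read off an integer model by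
`Rank1Residual.IntModel.hasMultiplicativeReductionAtPrime_of_intModel` / `padicValInt_eq_of_dvd_of_not_dvd`)
and a natural number `D` such that `−D` is an ODD negative fundamental discriminant (`−D ≡ 1 (mod 4)`,
squarefree): if `(−D/p) = 1`, `(−D/q) = −1`, no bad prime divides `D`, every bad `ℓ ≠ q` has
`(−D/ℓ) = 1` (`−D ≡ 1 (mod 8)` for `ℓ = 2`), `−D ≡ 1 (mod 8)` when `2` is good, and `p ∤ h(−D)` (the
form class number `BinaryQuadraticForm.classNumber`, `decide`-evaluable), then `L = ℚ(√−D)` is a scope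
witness: `L` exists with `d_L = −D` (`Quadratic.exists_numberField_discr_eq`), is imaginary quadratic
(`isImaginaryQuadratic_iff_discr_neg`), the splitting is the decomposition law
(`ncard_primesOver_eq_two_iff_jacobiSym`, `ncard_primesOver_two_eq_two_iff`,
`BSTWScope.ncard_primesOver_eq_one_of_jacobiSym_eq_neg_one`) and `h(−D) = h_L` (`card_reducedForms_eq_classNumber`,
Cox Thm. 7.7(ii)). This is the kernel form of one row of the cell's L-witness table (W-bstw-10).
[cite: Cox2013, §7.B Thm. 7.7(ii)] -/
theorem BSTWScope.hasWitness_of_kronecker (W : WeierstrassCurve ℚ) [W.IsGloballyMinimal] (p : ℕ)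
    [Fact p.Prime] (hp2 : p ≠ 2) (q : ℕ) [hq : Fact q.Prime]
    (haux : BSTWScope.IsAuxiliaryPrime W p q) (D : ℕ)
    (hfund : (-(D : ℤ)) % 4 = 1 ∧ Squarefree (-(D : ℤ)) ∧ (-(D : ℤ)) ≠ 1)
    (hsp : jacobiSym (-(D : ℤ)) p = 1) (hin : jacobiSym (-(D : ℤ)) q = -1)
    (hbadD : ∀ ℓ : ℕ, (hℓ : ℓ.Prime) →
      (haveI : Fact ℓ.Prime := ⟨hℓ⟩; ¬ W.HasGoodReductionAtPrime ℓ) → ¬ (ℓ : ℤ) ∣ (D : ℤ))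
    (hbad : ∀ ℓ : ℕ, (hℓ : ℓ.Prime) → ℓ ≠ q →
      (haveI : Fact ℓ.Prime := ⟨hℓ⟩; ¬ W.HasGoodReductionAtPrime ℓ) →
        (ℓ = 2 → (-(D : ℤ)) % 8 = 1) ∧ (ℓ ≠ 2 → jacobiSym (-(D : ℤ)) ℓ = 1))
    (htwo : W.HasGoodReductionAtPrime 2 → (-(D : ℤ)) % 8 = 1)
    (hclass : ¬ p ∣ BinaryQuadraticForm.classNumber (-(D : ℤ))) :
    BSTWScope.HasWitness W p := by
  obtain ⟨L, _instF, _instN, h2, hdisc⟩ := Quadratic.exists_numberField_discr_eq (D := -(D : ℤ)) (Or.inl hfund)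
  have hneg : NumberField.discr L < 0 := by rw [hdisc]; omega
  refine ⟨q, hq, L, _instF, _instN, haux, ⟨?_, ?_, ?_, ?_, ?_, ?_, ?_⟩, ?_⟩
  · exact (isImaginaryQuadratic_iff_discr_neg).mpr ⟨h2, hneg⟩
  · exact (Quadratic.ncard_primesOver_eq_two_iff_jacobiSym h2 Fact.out hp2).mpr (by rw [hdisc]; exact hsp)
  · exact BSTWScope.ncard_primesOver_eq_one_of_jacobiSym_eq_neg_one h2 hq.out (by rw [hdisc]; exact hin)
  · intro ℓ hℓ hℓq hbadℓ
    by_cases hℓ2 : ℓ = 2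
    · subst hℓ2
      have h8 := (hbad 2 hℓ hℓq hbadℓ).1 rfl
      have := (Quadratic.ncard_primesOver_two_eq_two_iff h2).mpr (by rw [hdisc]; exact h8)
      simpa using this
    · exact (Quadratic.ncard_primesOver_eq_two_iff_jacobiSym h2 hℓ hℓ2).mpr
        (by rw [hdisc]; exact (hbad ℓ hℓ hℓq hbadℓ).2 hℓ2)
  · rw [hdisc]; omega
  · intro ℓ hℓ hbadℓ
    rw [hdisc, Int.dvd_neg]
    exact hbadD ℓ hℓ hbadℓ
  · intro hgood2
    have := (Quadratic.ncard_primesOver_two_eq_two_iff h2).mpr (by rw [hdisc]; exact htwo hgood2)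
    simpa using this
  · rw [← Quadratic.card_reducedForms_eq_classNumber h2 hneg, hdisc]
    exact hclass

end Summit.BirchSwinnertonDyer.Rank1Residual.Supersingular

end
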